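import Literature.ModelTheory.Zilber.EACPeriodicCylinders
import HarnessLib

/-!
# One-parameter torus scalings `y ↦ y · t^ν` and density of `S + K·ν` (EAC ladder vocabulary)

Zilber's Exponential-Algebraic Closedness, case ladder (host summit Schanuel, cell `pub-schanuel`).
Elementary vocabulary and lemmas for the structural sub-rung "members of `EC(n, n-1)` whose torus
part is stable under a one-parameter subtorus `y ↦ y · t^ν` (TORUS-RULED varieties) meet the graph of
`exp`" (problem side: `Summits/Schanuel/Schanuel/Theorems/ZilberEacTorusRuled.lean`):

* `torusScale ν t` — the action `(x, y) ↦ (x, (yⱼ t^{νⱼ})ⱼ)` of `t ∈ Kˣ` through the cocharacter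
  `ν ∈ ℤⁿ`, and `IsTorusStable ν S` (the set `S` is a union of orbits); transport under the lattice
  change `Φ_U (x, y) = (U x, y^U)` of `EACMonomialChange`:
  `Φ_U (torusScale ν t z) = torusScale (U ν) t (Φ_U z)` — so for `U ν = g eᵢ` the transported set is
  stable under `yᵢ ↦ yᵢ t^g`, and its Zariski closure is a CYLINDER in `yᵢ`
  (`isCoordCylinder_zeroLocus_vanishingIdeal_of_scale`, over an algebraically closed field).
* `DenseModDir K ν S` — "`S + K·ν` is Zariski dense in `Kⁿ`" (no nonzero polynomial vanishes at all
  `x + t ν`, `x ∈ S`, `t ∈ K`); invariance under `ν ↦ g ν`, transport under `x ↦ U x`, and the link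
  with `HasDominantAddProjectionOff` of `EACPeriodicCylinders` for `ν = g eᵢ`.
* a small field fact: nonzero `g`-th roots (`exists_ne_zero_zpow_eq`).

Honest framing: elementary [folklore] material; nothing about `EC(3,2)` (OPEN) or Schanuel's
conjecture is asserted.
-/

noncomputable section

open MvPolynomial Matrix

namespace Literature.ModelTheory.Zilber

open Literature.NumberTheory.Transcendental

variable {K : Type*} [Field K] {n : ℕ}

/-! ## Nonzero `g`-th roots in an algebraically closed field -/

/-- In an algebraically closed field every `a ≠ 0` has a nonzero `g`-th root for every integer
`g ≠ 0` (negative `g`: a root of `a⁻¹`). [folklore] -/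
theorem exists_ne_zero_zpow_eq [IsAlgClosed K] {a : K} (ha : a ≠ 0) {g : ℤ} (hg : g ≠ 0) :
    ∃ t : K, t ≠ 0 ∧ t ^ g = a := by
  obtain ⟨m, rfl | rfl⟩ := Int.eq_nat_or_neg g
  · have hm : 0 < m := by omega
    obtain ⟨t, ht⟩ := IsAlgClosed.exists_pow_nat_eq a hm
    refine ⟨t, fun h0 => ha ?_, by rw [zpow_natCast, ht]⟩
    rw [← ht, h0, zero_pow hm.ne']
  · have hm : 0 < m := by omega
    obtain ⟨t, ht⟩ := IsAlgClosed.exists_pow_nat_eq a⁻¹ hm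
    refine ⟨t, fun h0 => inv_ne_zero ha ?_, by rw [_root_.zpow_neg, zpow_natCast, ht, inv_inv]⟩
    rw [← ht, h0, zero_pow hm.ne']

/-! ## One-parameter torus scalings `y ↦ y · t^ν` -/

/-- The cocharacter action of `t ∈ K` through `ν ∈ ℤⁿ` on the multiplicative coordinates:
`torusScale ν t (x, y) = (x, (yⱼ · t ^ νⱼ)ⱼ)` (junk for `t = 0` with negative exponents).
[folklore] -/
def torusScale (ν : Fin n → ℤ) (t : K) (z : Fin n ⊕ Fin n → K) : Fin n ⊕ Fin n → K :=
  Sum.elim (fun i => z (Sum.inl i)) (fun j => z (Sum.inr j) * t ^ ν j)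

/-- Additive coordinates are untouched. [folklore] -/
@[simp] theorem torusScale_inl (ν : Fin n → ℤ) (t : K) (z : Fin n ⊕ Fin n → K) (i : Fin n) :
    torusScale ν t z (Sum.inl i) = z (Sum.inl i) := rfl

/-- Multiplicative coordinates are scaled by `t ^ νⱼ`. [folklore] -/
@[simp] theorem torusScale_inr (ν : Fin n → ℤ) (t : K) (z : Fin n ⊕ Fin n → K) (j : Fin n) :
    torusScale ν t z (Sum.inr j) = z (Sum.inr j) * t ^ ν j := rfl

/-- `π(torusScale ν t z) = π(z)`. [folklore] -/
theorem projAdd_torusScale (ν : Fin n → ℤ) (t : K) (z : Fin n ⊕ Fin n → K) :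
    projAdd (torusScale ν t z) = projAdd z := rfl

/-- For `t ≠ 0` the scaling preserves the torus locus. [folklore] -/
theorem torusScale_mem_torusLocus {ν : Fin n → ℤ} {t : K} (ht : t ≠ 0) {z : Fin n ⊕ Fin n → K}
    (hz : z ∈ torusLocus K n) : torusScale ν t z ∈ torusLocus K n := fun j => by
  rw [torusScale_inr]
  exact mul_ne_zero (hz j) (zpow_ne_zero _ ht)

/-- Scaling through a coordinate cocharacter `g eᵢ` changes only `yᵢ ↦ yᵢ t^g`. [folklore] -/
theorem torusScale_single [DecidableEq (Fin n)] (i : Fin n) (g : ℤ) (t : K)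
    (z : Fin n ⊕ Fin n → K) :
    torusScale (Pi.single i g) t z = Function.update z (Sum.inr i) (z (Sum.inr i) * t ^ g) := by
  funext k
  rcases k with k | k
  · rw [torusScale_inl, Sum.update_inr_apply_inl]
  · rw [torusScale_inr]
    by_cases hk : k = i
    · subst hk
      rw [Pi.single_eq_same, Function.update_self]
    · rw [Pi.single_eq_of_ne hk, zpow_zero, mul_one,
        Function.update_of_ne (show (Sum.inr k : Fin n ⊕ Fin n) ≠ Sum.inr i by simpa using hk)]

/-- **`S` is stable under the one-parameter subtorus `t ↦ t^ν`**: with every point `(x, y)` it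
contains `(x, y · t^ν)` for all `t ≠ 0` — `S` is a union of cosets of the subtorus
`T_ν = {t^ν}` ("torus-ruled in the direction `ν`"). [folklore] -/
def IsTorusStable (ν : Fin n → ℤ) (S : Set (Fin n ⊕ Fin n → K)) : Prop :=
  ∀ z ∈ S, ∀ t : K, t ≠ 0 → torusScale ν t z ∈ S

/-- **The lattice change intertwines torus scalings**: on the torus locus,
`Φ_U (torusScale ν t z) = torusScale (U ν) t (Φ_U z)` for `t ≠ 0`
(`(yⱼ t^{νⱼ})^U = y^U · t^{U ν}`). [folklore] -/
theorem latticeChange_torusScale (U : Matrix (Fin n) (Fin n) ℤ) (ν : Fin n → ℤ) {t : K}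
    (ht : t ≠ 0) (z : Fin n ⊕ Fin n → K) :
    latticeChange U (torusScale ν t z) = torusScale (U *ᵥ ν) t (latticeChange U z) := by
  classical
  -- `∏ⱼ t ^ f j = t ^ ∑ⱼ f j` (`t ≠ 0`)
  have hprod : ∀ (s : Finset (Fin n)) (f : Fin n → ℤ), ∏ j ∈ s, t ^ f j = t ^ ∑ j ∈ s, f j := by
    intro s f
    induction s using Finset.induction_on with
    | empty => simp
    | insert i s hi ih => rw [Finset.prod_insert hi, Finset.sum_insert hi, zpow_add₀ ht, ih]
  funext k
  rcases k with i | i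
  · rfl
  · rw [latticeChange_inr, torusScale_inr, latticeChange_inr]
    simp only [monomialMap, projMul_apply, torusScale_inr]
    rw [Finset.prod_congr rfl fun j _ => mul_zpow (z (Sum.inr j)) (t ^ ν j) (U i j),
      Finset.prod_mul_distrib]
    congr 1
    rw [Finset.prod_congr rfl fun j _ => (_root_.zpow_mul t (ν j) (U i j)).symm, hprod]
    congr 1
    simp only [Matrix.mulVec, dotProduct]
    exact Finset.sum_congr rfl fun j _ => mul_comm _ _

/-- **Torus stability transports** under `Φ_U`: if `W ∩ Gⁿ` is `T_ν`-stable then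
`Φ_U(W ∩ Gⁿ)` is `T_{U ν}`-stable. [folklore] -/
theorem isTorusStable_latticeImage (U : Matrix (Fin n) (Fin n) ℤ) {ν : Fin n → ℤ}
    {W : Set (Fin n ⊕ Fin n → K)} (hst : IsTorusStable ν (W ∩ torusLocus K n)) :
    IsTorusStable (U *ᵥ ν) (latticeImage U W) := by
  rintro _ ⟨z, hz, rfl⟩ t ht
  exact ⟨torusScale ν t z, hst z hz t ht, latticeChange_torusScale U ν ht z⟩

/-- Stability under `t^{g ν}` for all `t ≠ 0` is stability under `s^{ν}` for all `s ≠ 0` when every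
nonzero scalar is a `g`-th power (algebraically closed field, `g ≠ 0`). [folklore] -/
theorem IsTorusStable.of_smul [IsAlgClosed K] {ν : Fin n → ℤ} {g : ℤ} (hg : g ≠ 0)
    {S : Set (Fin n ⊕ Fin n → K)} (h : IsTorusStable (g • ν) S) : IsTorusStable ν S := by
  intro z hz s hs
  obtain ⟨t, ht, rfl⟩ := exists_ne_zero_zpow_eq hs hg
  have key : torusScale ν (t ^ g) z = torusScale (g • ν) t z := by
    funext k
    rcases k with k | k
    · rfl
    · rw [torusScale_inr, torusScale_inr, Pi.smul_apply, smul_eq_mul, ← _root_.zpow_mul]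
  rw [key]
  exact h z hz t ht

/-- Conversely, stability under `T_ν` gives stability under `T_{g ν}` (any `g`). [folklore] -/
theorem IsTorusStable.smul {ν : Fin n → ℤ} {S : Set (Fin n ⊕ Fin n → K)} (h : IsTorusStable ν S)
    (g : ℤ) : IsTorusStable (g • ν) S := by
  intro z hz t ht
  have key : torusScale (g • ν) t z = torusScale ν (t ^ g) z := by
    funext k
    rcases k with k | k
    · rfl
    · rw [torusScale_inr, torusScale_inr, Pi.smul_apply, smul_eq_mul, ← _root_.zpow_mul]
  rw [key]
  exact h z hz _ (zpow_ne_zero g ht)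

/-! ## The closure of a `yᵢ`-scaling-stable subset of the torus is a cylinder in `yᵢ` -/

/-- The one-variable polynomial `T ↦ p(update w (inr i) T)`. [folklore] -/
theorem eval_lineThrough (w : Fin n ⊕ Fin n → K) (i : Fin n) (p : MvPolynomial (Fin n ⊕ Fin n) K)
    (s : K) :
    Polynomial.eval s (aeval (fun k => if k = Sum.inr i then Polynomial.X
        else Polynomial.C (w k)) p) =
      eval (Function.update w (Sum.inr i) s) p := by
  classical
  rw [← Polynomial.coe_aeval_eq_eval, ← AlgHom.comp_apply, comp_aeval]
  have hfun : (fun k => (Polynomial.aeval s) (if k = Sum.inr i then (Polynomial.X : Polynomial K)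
      else Polynomial.C (w k))) = Function.update w (Sum.inr i) s := by
    funext k
    by_cases hk : k = Sum.inr i
    · subst hk
      simp
    · rw [if_neg hk, Function.update_of_ne hk, Polynomial.aeval_C, Algebra.algebraMap_self_apply]
  rw [hfun]
  rfl

/-- **Scaling-stable ⇒ cylinder.** Let `S` lie off the hyperplane `yᵢ = 0` and be stable under
`yᵢ ↦ yᵢ t^g` for all `t ≠ 0` (`g ≠ 0`, algebraically closed field). Then the Zariski closure
`Z(I(S))` is a cylinder in the coordinate `yᵢ`: for `p ∈ I(S)` and `w ∈ S` the one-variable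
polynomial `T ↦ p(update w yᵢ T)` vanishes at every `T ≠ 0` (each is `wᵢ t^g`), hence identically,
so `p(Yᵢ ↦ c) ∈ I(S)` for every constant `c`. [folklore] -/
theorem isCoordCylinder_zeroLocus_vanishingIdeal_of_scale [IsAlgClosed K]
    {S : Set (Fin n ⊕ Fin n → K)} {i : Fin n} {g : ℤ} (hg : g ≠ 0)
    (hS : ∀ z ∈ S, z (Sum.inr i) ≠ 0)
    (hst : ∀ z ∈ S, ∀ t : K, t ≠ 0 → Function.update z (Sum.inr i) (z (Sum.inr i) * t ^ g) ∈ S) :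
    IsCoordCylinder (zeroLocus K (vanishingIdeal K S)) (Sum.inr i) := by
  classical
  intro z hz c
  rw [mem_zeroLocus_iff] at hz ⊢
  intro p hp
  -- the substituted polynomial `p(Yᵢ ↦ c)` lies in `I(S)`
  have hmem : bind₁ (Function.update X (Sum.inr i) (C c)) p ∈ vanishingIdeal K S := by
    rw [mem_vanishingIdeal_iff]
    intro w hw
    change eval w _ = 0
    rw [eval_bind₁_update_X_C]
    -- the polynomial `q(T) = p(update w yᵢ T)` has every nonzero `T` as a root
    set q : Polynomial K := aeval (fun k => if k = Sum.inr i then Polynomial.X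
        else Polynomial.C (w k)) p with hq
    have hroot : ∀ s : K, s ≠ 0 → q.IsRoot s := by
      intro s hs
      obtain ⟨t, ht, hts⟩ := exists_ne_zero_zpow_eq (div_ne_zero hs (hS w hw)) hg
      rw [Polynomial.IsRoot.def, hq, eval_lineThrough]
      have hs' : s = w (Sum.inr i) * t ^ g := by
        rw [hts, mul_div_cancel₀ _ (hS w hw)]
      rw [hs']
      exact (mem_vanishingIdeal_iff.1 hp) _ (hst w hw t ht)
    have hq0 : q = 0 := by
      refine Polynomial.eq_zero_of_infinite_isRoot q ?_
      refine (Set.finite_singleton (0 : K)).infinite_compl.mono ?_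
      intro s hs
      exact hroot s hs
    have := eval_lineThrough w i p c
    rw [← hq, hq0, Polynomial.eval_zero] at this
    exact this.symm
  have h := hz _ hmem
  change eval z _ = 0 at h
  rw [eval_bind₁_update_X_C] at h
  exact h

/-! ## Density of `S + K·ν` -/

variable (K) in
/-- **`S + K·ν` is Zariski dense in `Kⁿ`** (`ν ∈ ℤⁿ`): no nonzero polynomial vanishes at all
points `x + t ν`, `x ∈ S`, `t ∈ K`.  For `S` the base of a member of a cell `(n, n-1)` (an
irreducible hypersurface) this says exactly that the base is NOT a cylinder in the direction `ν`.
[folklore] -/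
def DenseModDir (ν : Fin n → ℤ) (S : Set (Fin n → K)) : Prop :=
  ∀ p : MvPolynomial (Fin n) K,
    (∀ x ∈ S, ∀ t : K, eval (x + t • fun i => (ν i : K)) p = 0) → p = 0

/-- `DenseModDir` is insensitive to scaling the direction by a nonzero integer. [folklore] -/
theorem denseModDir_smul_iff [CharZero K] {ν : Fin n → ℤ} {g : ℤ} (hg : g ≠ 0)
    (S : Set (Fin n → K)) : DenseModDir K (g • ν) S ↔ DenseModDir K ν S := by
  have hcast : (fun i => ((g • ν) i : K)) = (g : K) • fun i => (ν i : K) := by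
    funext i
    simp [Pi.smul_apply, smul_eq_mul]
  have hgK : (g : K) ≠ 0 := by exact_mod_cast hg
  constructor
  · intro h p hp
    refine h p fun x hx t => ?_
    rw [hcast, smul_smul]
    exact hp x hx _
  · intro h p hp
    refine h p fun x hx t => ?_
    have := hp x hx (t / g)
    rwa [hcast, smul_smul, div_mul_cancel₀ _ hgK] at this

/-- `U (t • ν) = t • (U ν)` for an integer direction `ν` and a scalar `t`. [folklore] -/
theorem intLinMap_smul_intCast (U : Matrix (Fin n) (Fin n) ℤ) (t : K) (ν : Fin n → ℤ) :
    intLinMap U (t • fun i => (ν i : K)) = t • fun i => ((U *ᵥ ν) i : K) := by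
  rw [← intLinMap_intCast]
  funext i
  simp only [intLinMap, Pi.smul_apply, smul_eq_mul, Finset.mul_sum]
  exact Finset.sum_congr rfl fun j _ => by ring

/-- **Density transports** under `x ↦ U x` (inverse pair): `S + K·ν` dense ⇒ `U S + K·(U ν)`
dense. [folklore] -/
theorem denseModDir_image_intLinMap {U V : Matrix (Fin n) (Fin n) ℤ} (hUV : U * V = 1)
    {ν : Fin n → ℤ} {S : Set (Fin n → K)} (h : DenseModDir K ν S) :
    DenseModDir K (U *ᵥ ν) (intLinMap U '' S) := by
  intro p hp
  have hq : linSubst U p = 0 := by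
    refine h _ fun x hx t => ?_
    rw [eval_linSubst, intLinMap_add, intLinMap_smul_intCast]
    exact hp _ ⟨x, hx, rfl⟩ t
  have : linSubst V (linSubst U p) = p := by
    rw [← AlgHom.comp_apply, linSubst_comp, hUV, linSubst_one, AlgHom.id_apply]
  rw [← this, hq, map_zero]

/-- **Density in a coordinate direction is `HasDominantAddProjectionOff`**: if
`π(V) + K·(g eᵢ)` is dense then `π(V) + K·eᵢ` is dense in the sense of
`EACPeriodicCylinders`. [folklore] -/
theorem hasDominantAddProjectionOff_of_denseModDir_single {i : Fin n} {g : ℤ}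
    {V : Set (Fin n ⊕ Fin n → K)} (h : DenseModDir K (Pi.single i g) (projAdd '' V)) :
    HasDominantAddProjectionOff K i V := by
  classical
  intro p hp
  refine h p ?_
  rintro _ ⟨z, hz, rfl⟩ t
  have key : (projAdd z + t • fun j => ((Pi.single i g : Fin n → ℤ) j : K)) =
      Function.update (projAdd z) i (projAdd z i + t * g) := by
    funext j
    by_cases hj : j = i
    · subst hj
      simp
    · simp [Function.update_of_ne hj, Pi.single_eq_of_ne hj]
  rw [key]
  exact hp z hz _

end Literature.ModelTheory.Zilber
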